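import Literature.NumberTheory.PAdicHodge.TateAlmostEtaleIntegralBases
import Literature.NumberTheory.PAdicHodge.CyclotomicTowerPthPowers
import Mathlib.FieldTheory.Finite.Basic

/-!
# Tate's almost étale lemma (TS1) — the almost-perfectoid package DESCENDS along prime-to-`p` extensions

For `K₀ ⊆ M ⊆ L ⊆ F̄` with `L/M` finite of degree `d` prime to `p`: if `L` has the almost-perfectoid package
((Γ): every norm is a `p`-th power of a norm; (U_s): every integer is a `p`-th power modulo `p^s`), then so
has `M` (with exponent `min s 1`). Both halves are elementary:
* (Γ): `‖N_{L/M}(c)‖ = ‖c‖^d` (isometric conjugates) and Bezout `d m = 1 + p k`;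
* (U): for `u ∈ 𝔬_M`, `u = w^p + r` in `L`; applying `d⁻¹ Tr_{L/M}` and comparing `Tr(w^p) = Σ σ(w)^p` with
  `(Σ σ w)^p = Tr(w)^p` (difference of norm `≤ ‖p‖`), and `d⁻¹ ≡ (d^{p-2})^p (mod p)` (Fermat), gives
  `u ≡ (d^{p-2} Tr(w))^p` modulo norm `≤ max ‖p‖ ‖p‖^s`.
This reduces the tame package (C) of `TateSenConditionKummerRoute` for a field `T` to the package of ANY
finite extension of `T` of degree prime to `p` (e.g. a radical tower containing it).
[cite: Tate1967, §3.2] [cite: Scholze2012, Lemma 3.2]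
-/

noncomputable section

open Polynomial IntermediateField Module ValuativeRel Field

namespace Literature.NumberTheory.PAdicHodge

namespace TateAlmostEtale

open Literature.NumberTheory.GaloisRepresentations
open Literature.NumberTheory.GaloisRepresentations.IsNonarchimedeanLocalField

variable {F : Type} [Field F] [ValuativeRel F] [TopologicalSpace F] [IsNonarchimedeanLocalField F]
  [CharZero F] {p : ℕ} [Fact p.Prime] (hp : valuation F p < 1)

variable (M : IntermediateField (PadicBase F p hp) (NormedAlgClosure F))
  (L : IntermediateField M (NormedAlgClosure F)) [FiniteDimensional M L]

/-- **(Γ) descends along prime-to-`p` extensions.** If `p ∤ [L:M]` and every norm of `L^×` is a `p`-th power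
of a norm of `L`, then every norm of `M^×` is a `p`-th power of a norm of `M` (`‖N_{L/M} c‖ = ‖c‖^d`,
Bezout). [cite: Tate1967, §3.2] -/
theorem descent_exists_norm_pow_eq (hd : ¬ p ∣ finrank M L)
    (hΓ : ∀ x ∈ L, x ≠ 0 → ∃ c ∈ L, ‖c‖ ^ p = ‖x‖)
    {x : NormedAlgClosure F} (hx : x ∈ M) (hx0 : x ≠ 0) :
    ∃ c ∈ M, ‖c‖ ^ p = ‖x‖ := by
  have hprime : p.Prime := Fact.out
  set d : ℕ := finrank M L with hdd
  have hxL : x ∈ L := L.algebraMap_mem ⟨x, hx⟩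
  obtain ⟨c', hc'L, hc'⟩ := hΓ x hxL hx0
  have hc'0 : c' ≠ 0 := by
    intro h; rw [h, norm_zero, zero_pow hprime.ne_zero] at hc'; exact hx0 (norm_eq_zero.mp hc'.symm)
  -- `c₁ = N_{L/M}(c') ∈ M`, `‖c₁‖ = ‖c'‖^d`
  set c₁ : NormedAlgClosure F := ((Algebra.norm M (⟨c', hc'L⟩ : L) : M) : NormedAlgClosure F) with hc₁
  have hc₁M : c₁ ∈ M := (Algebra.norm M (⟨c', hc'L⟩ : L)).2
  have hnc₁ : ‖c₁‖ = ‖c'‖ ^ d := by rw [hc₁, norm_norm_eq hp M L]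
  -- Bezout: `d m = p k + 1`
  have hcop : Nat.Coprime d p := (Nat.coprime_comm.mp ((Nat.Prime.coprime_iff_not_dvd hprime).mpr hd))
  obtain ⟨m, -, hm⟩ := Nat.exists_mul_mod_eq_one_of_coprime hcop hprime.one_lt
  set k : ℕ := d * m / p with hk
  have hdm : d * m = p * k + 1 := by rw [hk, ← hm, Nat.div_add_mod]
  have h1 : ‖c₁‖ ^ p = ‖x‖ ^ d := by rw [hnc₁, ← pow_mul, mul_comm, pow_mul, hc']
  refine ⟨c₁ ^ m * (x ^ k)⁻¹, mul_mem (pow_mem hc₁M m) (inv_mem (pow_mem hx k)), ?_⟩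
  rw [norm_mul, norm_inv, norm_pow, norm_pow, mul_pow, inv_pow, ← pow_mul, ← pow_mul, mul_comm m p,
    pow_mul, h1, ← pow_mul, hdm, mul_comm k p, pow_add, pow_one, mul_comm (‖x‖ ^ (p * k)) ‖x‖,
    mul_assoc, mul_inv_cancel₀ (pow_ne_zero _ (norm_ne_zero_iff.mpr hx0)), mul_one]

/-- `(p-1)^2 = (p-2) p + 1` for `p ≥ 2`. [folklore] -/
private theorem sq_pred_eq (hp2 : 2 ≤ p) : (p - 1) * (p - 1) = (p - 2) * p + 1 := by
  obtain ⟨k, rfl⟩ : ∃ k, p = k + 2 := ⟨p - 2, by omega⟩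
  have h1 : k + 2 - 1 = k + 1 := by omega
  have h2 : k + 2 - 2 = k := by omega
  rw [h1, h2]; ring

omit [CharZero F] in
/-- **Fermat in the form used for descent: `‖(d : F̄)^{(p-2)p+1} - 1‖ ≤ ‖p‖` for `p ∤ d`.** [folklore] -/
private theorem norm_pow_sq_pred_sub_one_le {d : ℕ} (hd : ¬ p ∣ d) :
    ‖(d : NormedAlgClosure F) ^ ((p - 2) * p + 1) - 1‖ ≤ ‖(p : NormedAlgClosure F)‖ := by
  have hprime : p.Prime := Fact.out
  have hcop : Nat.Coprime d p := Nat.coprime_comm.mp ((Nat.Prime.coprime_iff_not_dvd hprime).mpr hd)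
  have h1 : d ^ (p - 1) ≡ 1 [MOD p] := by
    have := Nat.ModEq.pow_totient hcop; rwa [Nat.totient_prime hprime] at this
  have h2 : d ^ ((p - 2) * p + 1) ≡ 1 [MOD p] := by
    rw [← sq_pred_eq hprime.two_le, pow_mul]
    simpa using h1.pow (p - 1)
  have hdpos : 0 < d := Nat.pos_of_ne_zero fun h => hd (by rw [h]; exact dvd_zero p)
  have h3 : p ∣ d ^ ((p - 2) * p + 1) - 1 := (Nat.modEq_iff_dvd' (Nat.one_le_pow _ _ hdpos)).mp h2.symm
  obtain ⟨j, hj⟩ := h3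
  have h4 : d ^ ((p - 2) * p + 1) = p * j + 1 := by
    have := Nat.one_le_pow ((p - 2) * p + 1) d hdpos; omega
  have : (d : NormedAlgClosure F) ^ ((p - 2) * p + 1) - 1 = (p : NormedAlgClosure F) * j := by
    rw [← Nat.cast_pow, h4]; push_cast; ring
  rw [this, norm_mul]
  exact mul_le_of_le_one_right (norm_nonneg _) (IsUltrametricDist.norm_natCast_le_one _ j)

set_option synthInstance.maxHeartbeats 200000 in
set_option maxHeartbeats 1600000 in
/-- **(U_s) descends along prime-to-`p` extensions (with exponent `min s 1`).** If `p ∤ [L:M]` and every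
integer of `L` is a `p`-th power modulo `p^s`, then every integer `u` of `M` is a `p`-th power modulo
`p^{min s 1}`: `u ≡ (d^{p-2} Tr_{L/M}(w))^p` where `u ≡ w^p` in `L` (normalised trace, `Tr(w^p)` versus `Tr(w)^p`,
Fermat). [cite: Tate1967, §3.2] [cite: Scholze2012, Lemma 3.2] -/
theorem descent_exists_norm_sub_pow_le (hd : ¬ p ∣ finrank M L) {s : ℝ} (hs : 0 < s)
    (hU : ∀ u ∈ L, ‖u‖ ≤ 1 → ∃ w ∈ L, ‖u - w ^ p‖ ≤ ‖(p : NormedAlgClosure F)‖ ^ s)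
    {u : NormedAlgClosure F} (hu : u ∈ M) (hu1 : ‖u‖ ≤ 1) :
    ∃ w ∈ M, ‖u - w ^ p‖ ≤ ‖(p : NormedAlgClosure F)‖ ^ (min s 1) := by
  classical
  have hprime : p.Prime := Fact.out
  have hp0 : (p : NormedAlgClosure F) ≠ 0 := Nat.cast_ne_zero.mpr hprime.ne_zero
  have hq0 : 0 < ‖(p : NormedAlgClosure F)‖ := norm_pos_iff.mpr hp0
  have hq1 : ‖(p : NormedAlgClosure F)‖ < 1 := by
    rw [PadicBase.norm_natCast_closure hp]; exact PadicBase.norm_p_lt_one hp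
  have hqs1 : ‖(p : NormedAlgClosure F)‖ ^ s ≤ 1 := Real.rpow_le_one hq0.le hq1.le hs.le
  have hqs : ‖(p : NormedAlgClosure F)‖ ^ s ≤ ‖(p : NormedAlgClosure F)‖ ^ (min s 1) :=
    Real.rpow_le_rpow_of_exponent_ge hq0 hq1.le (min_le_left s 1)
  have hq1' : ‖(p : NormedAlgClosure F)‖ ≤ ‖(p : NormedAlgClosure F)‖ ^ (min s 1) := by
    have h := Real.rpow_le_rpow_of_exponent_ge hq0 hq1.le (min_le_right s 1)
    rwa [Real.rpow_one] at h
  haveI : CharZero M := charZero_of_injective_algebraMap (algebraMap (PadicBase F p hp) M).injective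
  haveI : Algebra.IsSeparable M L := Algebra.IsAlgebraic.isSeparable_of_perfectField
  haveI : Module.Free M L := Module.Free.of_divisionRing M L
  set d : ℕ := finrank M L with hdd
  have hd0 : d ≠ 0 := fun h => hd (by rw [h]; exact dvd_zero p)
  have hdE : (d : NormedAlgClosure F) ≠ 0 := Nat.cast_ne_zero.mpr hd0
  have hnd : ‖(d : NormedAlgClosure F)‖ = 1 := norm_natCast_eq_one_of_not_dvd hprime hq1 hd
  -- `u = w'^p + r` in `L`, `‖w'‖ ≤ 1`
  have huL : u ∈ L := L.algebraMap_mem ⟨u, hu⟩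
  obtain ⟨w', hw'L, hw'⟩ := hU u huL hu1
  have hw'1 : ‖w'‖ ≤ 1 := by
    have h1 : ‖w' ^ p‖ ≤ 1 := by
      have : w' ^ p = u + -(u - w' ^ p) := by ring
      rw [this]
      refine (IsUltrametricDist.norm_add_le_max _ _).trans (max_le hu1 ?_)
      rw [norm_neg]; exact hw'.trans hqs1
    rw [norm_pow] at h1
    exact (pow_le_one_iff_of_nonneg (norm_nonneg _) hprime.ne_zero).mp h1
  -- the elements of `L` and their traces, read in `F̄`
  set z : L := ⟨w', hw'L⟩ with hz
  set uL : L := ⟨u, huL⟩ with huL'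
  have huLalg : uL = algebraMap M L ⟨u, hu⟩ := Subtype.ext rfl
  set rL : L := uL - z ^ p with hrL
  have hrE : ((rL : L) : NormedAlgClosure F) = u - w' ^ p := by
    rw [hrL]; push_cast; rfl
  have hnr : ‖((Algebra.trace M L rL : M) : NormedAlgClosure F)‖ ≤ ‖(p : NormedAlgClosure F)‖ ^ s := by
    refine (norm_trace_le hp M L rL).trans ?_
    rw [hrE]; exact hw'
  set T₁ : NormedAlgClosure F := ((Algebra.trace M L z : M) : NormedAlgClosure F) with hT₁
  have hT₁M : T₁ ∈ M := (Algebra.trace M L z).2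
  have hT₁n : ‖T₁‖ ≤ 1 := (norm_trace_le hp M L z).trans hw'1
  have htr_u : ((Algebra.trace M L uL : M) : NormedAlgClosure F) = d * u := by
    rw [huLalg, Algebra.trace_algebraMap, nsmul_eq_mul]
    push_cast
    rfl
  have htr_split : ((Algebra.trace M L (z ^ p) : M) : NormedAlgClosure F) =
      d * u - ((Algebra.trace M L rL : M) : NormedAlgClosure F) := by
    have : z ^ p = uL - rL := by rw [hrL]; ring
    rw [this, map_sub]
    push_cast
    rw [htr_u]
  -- traces as sums of (isometric) embeddings
  have hemb : ∀ y : L, ((Algebra.trace M L y : M) : NormedAlgClosure F) =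
      ∑ σ : L →ₐ[M] NormedAlgClosure F, σ y := fun y => by
    have h := trace_eq_sum_embeddings (NormedAlgClosure F) (K := M) (L := L) (x := y)
    rwa [IntermediateField.algebraMap_apply] at h
  have hzp : ((Algebra.trace M L (z ^ p) : M) : NormedAlgClosure F) =
      ∑ σ : L →ₐ[M] NormedAlgClosure F, (σ z) ^ p := by
    rw [hemb]; simp only [map_pow]
  set C : NormedAlgClosure F := T₁ ^ p - ∑ σ : L →ₐ[M] NormedAlgClosure F, (σ z) ^ p with hCdef
  have hCn : ‖C‖ ≤ ‖(p : NormedAlgClosure F)‖ := by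
    rw [hCdef, hT₁, hemb z]
    exact norm_sum_pow_sub_sum_pow_le hprime _ _
      (fun σ _ => by rw [norm_algHom_apply hp M L σ z]; exact hw'1)
  have hkey : (d : NormedAlgClosure F) * u =
      T₁ ^ p - C + ((Algebra.trace M L rL : M) : NormedAlgClosure F) := by
    rw [hCdef, ← hzp, htr_split]; ring
  -- the candidate `w = d^{p-2} · Tr(w')`
  refine ⟨(d : NormedAlgClosure F) ^ (p - 2) * T₁,
    mul_mem (pow_mem (_root_.natCast_mem M d) _) hT₁M, ?_⟩
  have hdinv : ‖(d : NormedAlgClosure F)⁻¹‖ = 1 := by rw [norm_inv, hnd, inv_one]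
  have hu_eq : u = (d : NormedAlgClosure F)⁻¹ *
      (T₁ ^ p - C + ((Algebra.trace M L rL : M) : NormedAlgClosure F)) := by
    rw [← hkey, ← mul_assoc, inv_mul_cancel₀ hdE, one_mul]
  have hdiff : u - ((d : NormedAlgClosure F) ^ (p - 2) * T₁) ^ p =
      -((d : NormedAlgClosure F)⁻¹ * ((d : NormedAlgClosure F) ^ ((p - 2) * p + 1) - 1)) * T₁ ^ p +
        (d : NormedAlgClosure F)⁻¹ *
          (((Algebra.trace M L rL : M) : NormedAlgClosure F) + -C) := by
    rw [hu_eq, mul_pow, ← pow_mul, pow_succ]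
    field_simp
    ring
  have hA : ‖(d : NormedAlgClosure F) ^ ((p - 2) * p + 1) - 1‖ ≤ ‖(p : NormedAlgClosure F)‖ :=
    norm_pow_sq_pred_sub_one_le hd
  have hB : ‖T₁ ^ p‖ ≤ 1 := by rw [norm_pow]; exact pow_le_one₀ (norm_nonneg _) hT₁n
  have hfirst : ‖-((d : NormedAlgClosure F)⁻¹ * ((d : NormedAlgClosure F) ^ ((p - 2) * p + 1) - 1)) *
      T₁ ^ p‖ ≤ ‖(p : NormedAlgClosure F)‖ := by
    rw [norm_mul, norm_neg, norm_mul, hdinv, one_mul]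
    have h := mul_le_mul hA hB (norm_nonneg _) hq0.le
    rwa [mul_one] at h
  have hsecond : ‖(d : NormedAlgClosure F)⁻¹ *
      (((Algebra.trace M L rL : M) : NormedAlgClosure F) + -C)‖ ≤
      ‖(p : NormedAlgClosure F)‖ ^ (min s 1) := by
    rw [norm_mul, hdinv, one_mul]
    refine (IsUltrametricDist.norm_add_le_max _ _).trans (max_le (hnr.trans hqs) ?_)
    rw [norm_neg]; exact hCn.trans hq1'
  rw [hdiff]
  exact (IsUltrametricDist.norm_add_le_max _ _).trans (max_le (hfirst.trans hq1') hsecond)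

/-- **The almost-perfectoid package descends along prime-to-`p` finite extensions** (both halves).
[cite: Tate1967, §3.2] [cite: Scholze2012, Lemma 3.2] -/
theorem package_descent (hd : ¬ p ∣ finrank M L) {s : ℝ} (hs : 0 < s)
    (hΓ : ∀ x ∈ L, x ≠ 0 → ∃ c ∈ L, ‖c‖ ^ p = ‖x‖)
    (hU : ∀ u ∈ L, ‖u‖ ≤ 1 → ∃ w ∈ L, ‖u - w ^ p‖ ≤ ‖(p : NormedAlgClosure F)‖ ^ s) :
    (∀ x ∈ M, x ≠ 0 → ∃ c ∈ M, ‖c‖ ^ p = ‖x‖) ∧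
      (∀ u ∈ M, ‖u‖ ≤ 1 → ∃ w ∈ M, ‖u - w ^ p‖ ≤ ‖(p : NormedAlgClosure F)‖ ^ (min s 1)) :=
  ⟨fun _ hx hx0 => descent_exists_norm_pow_eq hp M L hd hΓ hx hx0,
    fun _ hu hu1 => descent_exists_norm_sub_pow_le hp M L hd hs hU hu hu1⟩

end TateAlmostEtale

end Literature.NumberTheory.PAdicHodge

end
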